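import Summits.Ventures.Crystal3D.Theorems.StickyWulffConstantNoReconstructionGainPredSlotBudgetRaisedZones
import HarnessLib

/-!
# The pred-slot budget with a raised up bond, three contacts: zone lemmas for the residual systems

HONEST FRAMING. Part of the venture `Summits/Ventures/Crystal3D` (cell `crystal3d-full`), helper
`--supports` the crux `NoReconstructionGain` (stmt-Ventures-19144, route
`route-Ventures-StickyWulffConstant`), line `adhesion` (wulff-p1 g15).  Pure real-variable bricks for the
remaining piece B1b₃ (`predSlotBudget_of_upBond_raised_three`, skeleton v21: raised up bond, THREE
contacts) of the g13 brick `stub_predSlotBudget70`, in the cubic coordinates of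
`…PredSlotBudgetRaisedZones` ("region R": `n = (a,b,c)`, `a² + b² + c² = 2`, `−a + b + c ≥ √(2/3)`,
`b ≤ a`, `0 ≤ a + b`; contacts `x² + y² + z² = 2`, pairwise `x x' + y y' + z z' ≤ 1`; slots
`B₁ = (1,1,0)`, `B₂ = (1,0,1)`, `B₃ = (0,−1,1)`, `W₁ = (0,1,1)`, `W₂ = (−1,0,1)`, `W₃ = (−1,1,0)`).

After the landed-budget reduction (`…PredSlotBudgetRaisedLanded`) the three-contact brick reduces to
the configurations with a contact blocking `−W₃ = (1,−1,0)` while `W₃` is unblocked; `B₂` is then always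
credited (`b2_blocked_of_negW3`), and the Hall-type failure systems in which all blockings fall into a
two-element set of slots are refuted here for the EASY sets:
* `{B₂, W₂}` (`noConf_B2W2`: three contacts deeper than `c + |b|` that block neither `W₁` nor `B₃`);
* `{B₂, W₁}` (`noConf_B2W1`: the contacts block none of `B₁, B₃, W₂, W₃` and are deeper than `a + b`
  and `c − b`; a contact blocking neither `B₂` nor `W₁` is too shallow (`shallow_of_not_B2_W1`), a
  `W₁`-only contact is pinned to `W₁` itself (`eq_W1_of_W1_only`), a contact blocking both has cubic
  height `> 1` (`one_lt_z_of_B2_W1`), so no two `W₁`-blockers and no two `B₂`-only contacts coexist).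
WHAT THIS IS NOT: the failure set `{B₂, B₃}` (three contacts avoiding `W₁`, `W₂`) — the one hard
system, separate file; the frame-level statement; rung F-C1 not moved.
-/

namespace Summit.Ventures.Crystal3D.Theorems

/-! ### One contact -/

/-- A contact within `60°` of `−W₃ = (1,−1,0)` blocks neither `W₁` nor `W₂` (both at `120°` from `−W₃`). -/
theorem not_W1_W2_of_negW3 {x y z : ℝ} (hu : x ^ 2 + y ^ 2 + z ^ 2 = 2) (h : 1 < x - y) :
    y + z ≤ 1 ∧ z - x ≤ 1 := by
  have h1 : (x + z) ^ 2 ≤ 4 := by nlinarith [sq_nonneg (x - z), sq_nonneg y]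
  have h2 : (z - y) ^ 2 ≤ 4 := by nlinarith [sq_nonneg (z + y), sq_nonneg x]
  have h3 : x + z ≤ 2 := by nlinarith
  have h4 : z - y ≤ 2 := by nlinarith
  constructor <;> linarith

/-- **`B₂` is blocked by the `−W₃`-blocker beyond `B₂`'s depth.**  A contact blocking `−W₃` that is
deeper than `a + c` blocks `B₂` (region R): it has positive height, blocks a steep slot, not `W₁`/`W₂`,
and the `B₃`-only zone is at most `c + |b| ≤ a + c` deep. -/
theorem b2_blocked_of_negW3 {a b c T x y z : ℝ} (hn : a ^ 2 + b ^ 2 + c ^ 2 = 2)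
    (hs : Real.sqrt (2 / 3) ≤ -a + b + c) (hba : b ≤ a) (hab : 0 ≤ a + b)
    (hu : x ^ 2 + y ^ 2 + z ^ 2 = 2) (hd : T ≤ a * x + b * y + c * z) (hT : a + c < T)
    (h : 1 < x - y) : 1 < x + z := by
  obtain ⟨ha, hab', -, -, hs0c, hac⟩ := regionR_bounds hn hs hba hab
  have hbabs : |b| ≤ a := abs_le.2 ⟨by linarith, hba⟩
  obtain ⟨nW1, nW2⟩ := not_W1_W2_of_negW3 hu h
  have hz : 0 < z := by
    by_contra hz; push Not at hz
    have := flat_depth_le hn hs hba hab hu hz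
    linarith
  rcases steep_cover hu hz with p | m | q | r
  · exact p
  · exact absurd m (not_lt.2 nW2)
  · exact absurd q (not_lt.2 nW1)
  · by_contra p; push Not at p
    have := depth_le_of_B3zone hn hs hba hab hu r p nW2
    linarith

/-- **The failure set `{B₂, W₂}` is impossible.**  Three pairwise non-overlapping contacts deeper than
`c + |b|` (so all of positive height) that block neither `W₁` nor `B₃`: a `W₂`-blocker among them would
lie in the `W₂`-only zone, at most `c − a` deep; so all three are in the `B₂`-only zone, and two of them
on the same side — contradiction. -/
theorem noConf_B2W2 {a b c T x₁ y₁ z₁ x₂ y₂ z₂ x₃ y₃ z₃ : ℝ} (hn : a ^ 2 + b ^ 2 + c ^ 2 = 2)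
    (hs : Real.sqrt (2 / 3) ≤ -a + b + c) (hba : b ≤ a) (hab : 0 ≤ a + b)
    (hu₁ : x₁ ^ 2 + y₁ ^ 2 + z₁ ^ 2 = 2) (hd₁ : T ≤ a * x₁ + b * y₁ + c * z₁)
    (hu₂ : x₂ ^ 2 + y₂ ^ 2 + z₂ ^ 2 = 2) (hd₂ : T ≤ a * x₂ + b * y₂ + c * z₂)
    (hu₃ : x₃ ^ 2 + y₃ ^ 2 + z₃ ^ 2 = 2) (hd₃ : T ≤ a * x₃ + b * y₃ + c * z₃)
    (h12 : x₁ * x₂ + y₁ * y₂ + z₁ * z₂ ≤ 1) (h13 : x₁ * x₃ + y₁ * y₃ + z₁ * z₃ ≤ 1)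
    (h23 : x₂ * x₃ + y₂ * y₃ + z₂ * z₃ ≤ 1)
    (hTp : c - b < T) (hTm : b + c < T)
    (q₁ : y₁ + z₁ ≤ 1) (q₂ : y₂ + z₂ ≤ 1) (q₃ : y₃ + z₃ ≤ 1)
    (r₁ : z₁ - y₁ ≤ 1) (r₂ : z₂ - y₂ ≤ 1) (r₃ : z₃ - y₃ ≤ 1) : False := by
  obtain ⟨ha, hab', -, -, hs0c, hac⟩ := regionR_bounds hn hs hba hab
  have hpos : 0 < Real.sqrt (2 / 3) := Real.sqrt_pos.2 (by norm_num)
  have hbabs : |b| ≤ c := abs_le.2 ⟨by linarith, by linarith⟩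
  have hTabs : c + |b| < T := by
    rcases le_or_gt 0 b with hb | hb
    · rw [abs_of_nonneg hb]; linarith
    · rw [abs_of_neg hb]; linarith
  -- every contact has positive height and lies in the `B₂`-only zone
  have key : ∀ x y z : ℝ, x ^ 2 + y ^ 2 + z ^ 2 = 2 → T ≤ a * x + b * y + c * z → y + z ≤ 1 →
      z - y ≤ 1 → 1 < x + z := by
    intro x y z hu hd q r
    have hz : 0 < z := by
      by_contra hz; push Not at hz
      have := flat_depth_le hn hs hba hab hu hz
      linarith
    rcases steep_cover hu hz with p | m | q' | r'
    · exact p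
    · by_contra p; push Not at p
      have hx := zone_one_le (x := -x) (y := y) (z := z) (by nlinarith) (by linarith) q r
      have := depth_le_of_M (b := b) ha hbabs (by linarith : x ≤ -1) q r
      linarith
    · exact absurd q' (not_lt.2 q)
    · exact absurd r' (not_lt.2 r)
  have p₁ := key x₁ y₁ z₁ hu₁ hd₁ q₁ r₁
  have p₂ := key x₂ y₂ z₂ hu₂ hd₂ q₂ r₂
  have p₃ := key x₃ y₃ z₃ hu₃ hd₃ q₃ r₃
  -- two of the three `y`'s have the same sign
  rcases le_or_gt 0 y₁ with s₁ | s₁ <;> rcases le_or_gt 0 y₂ with s₂ | s₂ <;>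
    rcases le_or_gt 0 y₃ with s₃ | s₃
  · linarith [zone_pair_gt_one hu₁ hu₂ p₁ q₁ r₁ p₂ q₂ r₂ (mul_nonneg s₁ s₂)]
  · linarith [zone_pair_gt_one hu₁ hu₂ p₁ q₁ r₁ p₂ q₂ r₂ (mul_nonneg s₁ s₂)]
  · linarith [zone_pair_gt_one hu₁ hu₃ p₁ q₁ r₁ p₃ q₃ r₃ (mul_nonneg s₁ s₃)]
  · linarith [zone_pair_gt_one hu₂ hu₃ p₂ q₂ r₂ p₃ q₃ r₃ (mul_pos_of_neg_of_neg s₂ s₃).le]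
  · linarith [zone_pair_gt_one hu₂ hu₃ p₂ q₂ r₂ p₃ q₃ r₃ (mul_nonneg s₂ s₃)]
  · linarith [zone_pair_gt_one hu₁ hu₃ p₁ q₁ r₁ p₃ q₃ r₃ (mul_pos_of_neg_of_neg s₁ s₃).le]
  · linarith [zone_pair_gt_one hu₁ hu₂ p₁ q₁ r₁ p₂ q₂ r₂ (mul_pos_of_neg_of_neg s₁ s₂).le]
  · linarith [zone_pair_gt_one hu₁ hu₂ p₁ q₁ r₁ p₂ q₂ r₂ (mul_pos_of_neg_of_neg s₁ s₂).le]

/-! ### The failure set `{B₂, W₁}` -/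

/-- A contact blocking neither `B₂` nor `W₁` (nor `B₁`, `B₃`, `W₂`) is at most `max (a + b) (c − b)`
deep (region R): of positive height it would block a steep slot; flat, it is at most `c + |b| = c − b`
deep when `b < 0`, and when `b ≥ 0` the bound `a + b` follows from `y ≤ 1 − z`, `y, z ≤ 1 − x`. -/
theorem shallow_of_not_B2_W1 {a b c T x y z : ℝ} (hn : a ^ 2 + b ^ 2 + c ^ 2 = 2)
    (hs : Real.sqrt (2 / 3) ≤ -a + b + c) (hba : b ≤ a) (hab : 0 ≤ a + b)
    (hu : x ^ 2 + y ^ 2 + z ^ 2 = 2) (hd : T ≤ a * x + b * y + c * z)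
    (hT1 : a + b < T) (hT2 : c - b < T)
    (p : x + z ≤ 1) (q : y + z ≤ 1) (hB1 : x + y ≤ 1) (r : z - y ≤ 1) (m : z - x ≤ 1) : False := by
  obtain ⟨ha, hab', -, -, hs0c, hac⟩ := regionR_bounds hn hs hba hab
  have hpos : 0 < Real.sqrt (2 / 3) := Real.sqrt_pos.2 (by norm_num)
  rcases lt_or_ge 0 z with hz | hz
  · rcases steep_cover hu hz with p' | m' | q' | r'
    · exact absurd p' (not_lt.2 p)
    · exact absurd m' (not_lt.2 m)
    · exact absurd q' (not_lt.2 q)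
    · exact absurd r' (not_lt.2 r)
  · rcases lt_or_ge b 0 with hb | hb
    · have := flat_depth_le hn hs hba hab hu hz
      rw [abs_of_neg hb] at this
      linarith
    · rcases le_or_gt x 1 with hx | hx
      · -- `a x ≤ a`, `b y ≤ b (1 − z)`, `(c − b) z ≤ 0`
        have e1 : a * x ≤ a * 1 := mul_le_mul_of_nonneg_left hx ha
        have e2 : b * y ≤ b * (1 - z) := mul_le_mul_of_nonneg_left (by linarith) hb
        have e3 : (c - b) * z ≤ 0 := mul_nonpos_of_nonneg_of_nonpos (by linarith) hz
        nlinarith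
      · -- `x > 1`: `y, z ≤ 1 − x < 0`, depth `< a`
        have e2 : b * y ≤ b * (1 - x) := mul_le_mul_of_nonneg_left (by linarith) hb
        have e3 : c * z ≤ c * (1 - x) := mul_le_mul_of_nonneg_left (by linarith) (by linarith)
        have e4 : 0 < (b + c - a) * (x - 1) := mul_pos (by linarith) (by linarith)
        nlinarith

/-- A `W₁`-blocker that blocks none of `B₂`, `W₂`, `B₁`, `W₃` IS `W₁ = (0,1,1)`. -/
theorem eq_W1_of_W1_only {x y z : ℝ} (hu : x ^ 2 + y ^ 2 + z ^ 2 = 2) (q : 1 < y + z)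
    (p : x + z ≤ 1) (m : z - x ≤ 1) (hB1 : x + y ≤ 1) (hW3 : y - x ≤ 1) :
    x = 0 ∧ y = 1 ∧ z = 1 := by
  have hy := zone_one_le (x := y) (y := x) (z := z) (by linarith) q p m
  have hx0 : x = 0 := by apply le_antisymm <;> linarith
  have hy1 : y = 1 := by apply le_antisymm <;> linarith
  subst hx0; subst hy1
  have hz2 : z ^ 2 = 1 := by nlinarith
  have hz : 0 < z := by linarith
  refine ⟨rfl, rfl, ?_⟩
  nlinarith

/-- A contact blocking both `B₂` and `W₁` but not `B₁` has cubic height `> 1`. -/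
theorem one_lt_z_of_B2_W1 {x y z : ℝ} (hu : x ^ 2 + y ^ 2 + z ^ 2 = 2) (p : 1 < x + z)
    (q : 1 < y + z) (hB1 : x + y ≤ 1) : 1 < z := by
  have e : 0 < (x - (1 - z)) * (y - (1 - z)) := mul_pos (by linarith) (by linarith)
  nlinarith [sq_nonneg (x - y)]

/-- **No two `W₁`-blockers** among contacts that block none of `B₁, B₃, W₂, W₃`: each is `W₁` itself
or has height `> 1` with `x, y > 0`; two such are strictly less than `60°` apart. -/
theorem W1_pair_false {x y z x' y' z' : ℝ} (hu : x ^ 2 + y ^ 2 + z ^ 2 = 2)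
    (hu' : x' ^ 2 + y' ^ 2 + z' ^ 2 = 2) (h : x * x' + y * y' + z * z' ≤ 1)
    (q : 1 < y + z) (q' : 1 < y' + z')
    (hB1 : x + y ≤ 1) (r : z - y ≤ 1) (m : z - x ≤ 1) (hW3 : y - x ≤ 1)
    (hB1' : x' + y' ≤ 1) (r' : z' - y' ≤ 1) (m' : z' - x' ≤ 1) (hW3' : y' - x' ≤ 1) : False := by
  by_cases p : 1 < x + z
  · have hz := one_lt_z_of_B2_W1 hu p q hB1
    have hx : 0 < x := by linarith
    have hy : 0 < y := by linarith
    by_cases p' : 1 < x' + z'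
    · have hz' := one_lt_z_of_B2_W1 hu' p' q' hB1'
      have hx' : 0 < x' := by linarith
      have hy' : 0 < y' := by linarith
      nlinarith [mul_pos hx hx', mul_pos hy hy', mul_pos (sub_pos.2 hz) (sub_pos.2 hz')]
    · push Not at p'
      obtain ⟨rfl, rfl, rfl⟩ := eq_W1_of_W1_only hu' q' p' m' hB1' hW3'
      linarith
  · push Not at p
    obtain ⟨rfl, rfl, rfl⟩ := eq_W1_of_W1_only hu q p m hB1 hW3
    linarith

/-- **No two `B₂`-only contacts** among contacts that do not block `B₁` (both have `x ≥ 1`, `y ≤ 0`). -/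
theorem B2only_pair_false {x y z x' y' z' : ℝ} (hu : x ^ 2 + y ^ 2 + z ^ 2 = 2)
    (hu' : x' ^ 2 + y' ^ 2 + z' ^ 2 = 2) (h : x * x' + y * y' + z * z' ≤ 1)
    (p : 1 < x + z) (q : y + z ≤ 1) (r : z - y ≤ 1) (hB1 : x + y ≤ 1)
    (p' : 1 < x' + z') (q' : y' + z' ≤ 1) (r' : z' - y' ≤ 1) (hB1' : x' + y' ≤ 1) : False := by
  have hx := zone_one_le hu p q r
  have hx' := zone_one_le hu' p' q' r'
  have hyy : 0 ≤ y * y' := mul_nonneg_of_nonpos_of_nonpos (by linarith) (by linarith)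
  linarith [zone_pair_gt_one hu hu' p q r p' q' r' hyy]

/-- **The failure set `{B₂, W₁}` is impossible.**  Three pairwise non-overlapping contacts deeper than
`a + b` and `c − b` that block none of `B₁, B₃, W₂, W₃`: each blocks `B₂` or `W₁`; at most one blocks
`W₁`, so two are `B₂`-only — contradiction. -/
theorem noConf_B2W1 {a b c T x₁ y₁ z₁ x₂ y₂ z₂ x₃ y₃ z₃ : ℝ} (hn : a ^ 2 + b ^ 2 + c ^ 2 = 2)
    (hs : Real.sqrt (2 / 3) ≤ -a + b + c) (hba : b ≤ a) (hab : 0 ≤ a + b)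
    (hu₁ : x₁ ^ 2 + y₁ ^ 2 + z₁ ^ 2 = 2) (hd₁ : T ≤ a * x₁ + b * y₁ + c * z₁)
    (hu₂ : x₂ ^ 2 + y₂ ^ 2 + z₂ ^ 2 = 2) (hd₂ : T ≤ a * x₂ + b * y₂ + c * z₂)
    (hu₃ : x₃ ^ 2 + y₃ ^ 2 + z₃ ^ 2 = 2) (hd₃ : T ≤ a * x₃ + b * y₃ + c * z₃)
    (h12 : x₁ * x₂ + y₁ * y₂ + z₁ * z₂ ≤ 1) (h13 : x₁ * x₃ + y₁ * y₃ + z₁ * z₃ ≤ 1)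
    (h23 : x₂ * x₃ + y₂ * y₃ + z₂ * z₃ ≤ 1)
    (hT1 : a + b < T) (hT2 : c - b < T)
    (b₁ : x₁ + y₁ ≤ 1) (b₂ : x₂ + y₂ ≤ 1) (b₃ : x₃ + y₃ ≤ 1)
    (r₁ : z₁ - y₁ ≤ 1) (r₂ : z₂ - y₂ ≤ 1) (r₃ : z₃ - y₃ ≤ 1)
    (m₁ : z₁ - x₁ ≤ 1) (m₂ : z₂ - x₂ ≤ 1) (m₃ : z₃ - x₃ ≤ 1)
    (w₁ : y₁ - x₁ ≤ 1) (w₂ : y₂ - x₂ ≤ 1) (w₃ : y₃ - x₃ ≤ 1) : False := by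
  -- each contact blocks `B₂` or `W₁`
  have t₁ : 1 < x₁ + z₁ ∨ 1 < y₁ + z₁ := by
    by_contra h; push Not at h
    exact shallow_of_not_B2_W1 hn hs hba hab hu₁ hd₁ hT1 hT2 h.1 h.2 b₁ r₁ m₁
  have t₂ : 1 < x₂ + z₂ ∨ 1 < y₂ + z₂ := by
    by_contra h; push Not at h
    exact shallow_of_not_B2_W1 hn hs hba hab hu₂ hd₂ hT1 hT2 h.1 h.2 b₂ r₂ m₂
  have t₃ : 1 < x₃ + z₃ ∨ 1 < y₃ + z₃ := by
    by_contra h; push Not at h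
    exact shallow_of_not_B2_W1 hn hs hba hab hu₃ hd₃ hT1 hT2 h.1 h.2 b₃ r₃ m₃
  -- at most one `W₁`-blocker; two `B₂`-only contacts are impossible
  by_cases q₁ : 1 < y₁ + z₁ <;> by_cases q₂ : 1 < y₂ + z₂ <;> by_cases q₃ : 1 < y₃ + z₃
  · exact W1_pair_false hu₁ hu₂ h12 q₁ q₂ b₁ r₁ m₁ w₁ b₂ r₂ m₂ w₂
  · exact W1_pair_false hu₁ hu₂ h12 q₁ q₂ b₁ r₁ m₁ w₁ b₂ r₂ m₂ w₂
  · exact W1_pair_false hu₁ hu₃ h13 q₁ q₃ b₁ r₁ m₁ w₁ b₃ r₃ m₃ w₃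
  · push Not at q₂ q₃
    exact B2only_pair_false hu₂ hu₃ h23 (t₂.resolve_right (not_lt.2 q₂)) q₂ r₂ b₂
      (t₃.resolve_right (not_lt.2 q₃)) q₃ r₃ b₃
  · exact W1_pair_false hu₂ hu₃ h23 q₂ q₃ b₂ r₂ m₂ w₂ b₃ r₃ m₃ w₃
  · push Not at q₁ q₃
    exact B2only_pair_false hu₁ hu₃ h13 (t₁.resolve_right (not_lt.2 q₁)) q₁ r₁ b₁
      (t₃.resolve_right (not_lt.2 q₃)) q₃ r₃ b₃
  · push Not at q₁ q₂
    exact B2only_pair_false hu₁ hu₂ h12 (t₁.resolve_right (not_lt.2 q₁)) q₁ r₁ b₁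
      (t₂.resolve_right (not_lt.2 q₂)) q₂ r₂ b₂
  · push Not at q₁ q₂
    exact B2only_pair_false hu₁ hu₂ h12 (t₁.resolve_right (not_lt.2 q₁)) q₁ r₁ b₁
      (t₂.resolve_right (not_lt.2 q₂)) q₂ r₂ b₂

end Summit.Ventures.Crystal3D.Theorems
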